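import Summits.Ventures.PercRepro2.CaseOneStarCertT1
import Summits.Ventures.PercRepro2.CaseOneGadgetUWA1BBlockII0
import Summits.Ventures.PercRepro2.CaseOneGadgetUWA1BBlockII1
import Summits.Ventures.PercRepro2.CaseOneGadgetUWA1BBlockII2
import Summits.Ventures.PercRepro2.CaseOneGadgetUWA1BBlockII3
import Summits.Ventures.PercRepro2.CaseOneGadgetUWA1BBlockII4
import Summits.Ventures.PercRepro2.CaseOneGadgetUWA1BBlockII5
import Summits.Ventures.PercRepro2.CaseOneGadgetUWA1BBlockII6
import Summits.Ventures.PercRepro2.CaseOneGadgetUWA1BBlockII7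
import Summits.Ventures.PercRepro2.CaseOneGadgetUWA1BBlockII8
import Summits.Ventures.PercRepro2.CaseOneGadgetUWA1BBlockII9
import Summits.Ventures.PercRepro2.CaseOneGadgetUWA1BBlockII10
import Summits.Ventures.PercRepro2.CaseOneGadgetUWA1BBlockII11
import Summits.Ventures.PercRepro2.CaseOneGadgetUWA1BBlockII12
import Summits.Ventures.PercRepro2.CaseOneGadgetUWA1BBlockII13
import Summits.Ventures.PercRepro2.CaseOneGadgetUWA1BBlockII14
import Summits.Ventures.PercRepro2.CaseOneStarFactsB

/-!
# The gadget `u ~ {w, a₁, b}`, `w ~ {u, a₂, o}` (uwa1b): the cell certificates of `iiAB5` (part 34a)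
(blind cell PercRepro2, p1 g34; the fourth gadget anchor of the six-form calculus — all six forms of the uwa1b gadget
as plain SFacts-cone certificate chains, generated by mining/p1/g34/uwa1b/genu.py = p1 g33's gent_uwa1.py / g25's
geno.py re-targeted; P1-G33 §6–§6″, P1-G34)

Each `eBABII ijk kl` is a nonnegative combination of `(pairwise atom) × (cell)` and cubic cell monomials — or, for the degree-4 ones, `M × eBABII ijk kl` (`M = Σ cᵢ` the total cell mass) is a nonnegative combination of `(atom) × (cell) × (cell)` and quartic cell monomials, then `SFacts.nonneg_of_sum_mul` (`CaseOneStarCertT1`) — exact LP certificates (kit j318477, every certificate re-verified exactly; data/p1/g33/gcerts_ii_uwa1b.json, form `ii`), here as exact `linear_combination`s over `SFacts` (the rational coefficients cleared by their common denominator). -/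

namespace Summit.Ventures.PercRepro2

namespace CaseOne

section CertABII34a
variable {R : Type*} [Field R] [LinearOrder R] [IsStrictOrderedRing R]

set_option maxHeartbeats 0 in
/-- `eBABII23211 ≥ 0`: the combination is identically zero (`ring`). -/
lemma eBABII23211_nonneg (m : SCells R) (_hf : SFactsB m) : 0 ≤ eBABII23211 m := by
  have h : eBABII23211 m = 0 := by
    unfold eBABII23211 cBABII00111 cBABII00211 cBABII01011 cBABII01111 cBABII01211 cBABII02011 cBABII02111 cBABII02211 cBABII03111 cBABII03211 cBABII10011 cBABII10111 cBABII10211 cBABII11011 cBABII11111 cBABII11211 cBABII12011 cBABII12111 cBABII12211 cBABII13011 cBABII13111 cBABII13211 cBABII20011 cBABII20111 cBABII20211 cBABII21011 cBABII21111 cBABII21211 cBABII22011 cBABII22111 cBABII22211 cBABII23011 cBABII23111 cBABII23211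
    ring
  linarith [h]

set_option maxHeartbeats 0 in
/-- `eBABII23212 ≥ 0`: the combination is identically zero (`ring`). -/
lemma eBABII23212_nonneg (m : SCells R) (_hf : SFactsB m) : 0 ≤ eBABII23212 m := by
  have h : eBABII23212 m = 0 := by
    unfold eBABII23212 cBABII00112 cBABII00212 cBABII01012 cBABII01112 cBABII01212 cBABII02012 cBABII02112 cBABII02212 cBABII03112 cBABII03212 cBABII10012 cBABII10112 cBABII10212 cBABII11012 cBABII11112 cBABII11212 cBABII12012 cBABII12112 cBABII12212 cBABII13012 cBABII13112 cBABII13212 cBABII20012 cBABII20112 cBABII20212 cBABII21012 cBABII21112 cBABII21212 cBABII22012 cBABII22112 cBABII22212 cBABII23012 cBABII23112 cBABII23212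
    ring
  linarith [h]

end CertABII34a

end CaseOne

end Summit.Ventures.PercRepro2
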